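import Literature.IUT.HodgeArakelov.MonoThetaProjectiveThetaEnvFacts
import Literature.IUT.HodgeArakelov.MonoThetaProjectiveBridgeEtThFacts
import Literature.AnabelianGeometry.EtaleTheta.Discharge.Sec2Cor218iModel

/-!
# [IUTchII] Prop. 1.4 / 1.5 (i), (i)′, (ii), (iii) for the NATURAL projective system of the genuine [EtTh] model
# with no [EtTh] §2 Cor. 2.18 (i) FACT input — the binder «Cor. 2.18 (i) at every chain level» (F-0620) SUPPLIED
# from the [EtTh] Thm. 1.6 (i) sub-DAG inputs; Cor. 2.19 (iii) (F-0650 → F-0652) remains BY NAME (proof-only capstone)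

v2 (doc-only; abc-iut-w4-d038 gen 4): title, the sentence before the bullet list and the headline of
`prop14_15_modelSystem_of_thm16Inputs` reworded per the RQ7 second read of abc-iut-w5-d115 (AUDIT-p423650, label
advisory A1): the file removes the Cor. 2.18 (i) binder (F-0620) only; the [EtTh] §2 statement Cor. 2.19 (iii)
(`ThetaEnvTower.Cor219_iii`, F-0650, tree route via F-0652 `MuTwoSetting.Cor219_iii_std`) is still taken BY NAME,
as the binder lists below already said. No declaration, statement or proof changed.

S. Mochizuki, *Inter-universal Teichmüller theory II*, §1, Prop. 1.5, kurims manuscript (Dec. 2020) p. 29 l. 18 ff.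
(own render paper:url-5036b4059555 p0029): (i) "Such a projective system is uniquely determined, up to isomorphism,
by `X̲̲_k`"; (ii) the transition morphisms induce isomorphisms of `Π_X(−)` and every isomorphism lifts; (iii) the
exterior cyclotomes with the cyclotomic rigidity isomorphism and `θ_env`. [claim: Mochizuki2012, status: disputed]
(IUTchII §1 Prop 1.5, kurims p.29); [EtTh] Cor. 2.18 (i) PRIMS PDF p. 60, proof p. 62 "described in the proofs of
Propositions 1.8, 2.4 … [Mzk2], Lemma 1.3.8 … Corollary 2.9" [cite: MochizukiEtTh2009, Cor 2.18(i) p.60].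

abc-iut cell, layer L6; seat abc-iut-w4-d038 (gen 3). PROOF-ONLY companion (no definition, no new named fact) of
abc-iut-L2-t10's two capstones for DAG nodes **IUTchII:Prop1.5(i)–(iii)** (+ Prop. 1.4 transitions) at the genuine
models, `MonoThetaProjectiveThetaEnvFacts` (`EtaleLevels.prop15_i_i'_ii_iii_modelSystem_of_origin`, p417636) and
`MonoThetaProjectiveBridgeEtThFacts` (`EtaleLevels.prop15_modelSystem_of_origin`, p417590). Both take, BY NAME,
`h218i : ∀ e : Es, (C.rigidData (τ.mod e) hC hS h15 L).Cor218_i` — [EtTh] Cor. 2.18 (i) at every level of the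
compatible cyclotome tower `τ` (abc-iut-L2-t2's named FACT `RigidData.Cor218_i`, FACT-LIST F-0620, FACT-policy). As for
[IUTchII] Cor. 1.10 (`ModelMonoThetaCor110Thm16`, p421899), abc-iut-L6-d6's `rigidData_cor218_i_of_thm16Inputs`
(`Discharge/Sec2Cor218iModel`, p420155) supplies it at EVERY identification `μ := τ.mod e` from the inputs of the
[EtTh] Thm. 1.6 (i) sub-DAG (`plan/L2/SUBDAG-EtTh-Thm16.md`), so that the whole [IUTchII] §1 natural-system node
family carries ONE binder list with no Cor. 2.18 (i) FACT binder (the only [EtTh] §2 FACT-policy statement left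
in it is Cor. 2.19 (iii), `ThetaEnvTower.Cor219_iii`, F-0650, taken BY NAME):

* `EtaleLevels.cor218_i_chain_of_thm16Inputs` — `h218i` at every chain level `e ∈ E` from the Thm. 1.6 (i) inputs;
* `EtaleLevels.prop14_15_modelSystem_of_thm16Inputs` — ONE theorem, four conjuncts: (a) the transitions of the
  natural system induce isomorphisms on `Π_X(−)` (`transitionsAreIsos`, the Prop. 1.4 / 1.5 (ii) transition clause);
  (b) Prop. 1.5 (ii)+(iii) `Prop15_ii_iii` of the natural system; (c) Prop. 1.5 (i) as printed — every compatible
  system over the model family is isomorphic to the natural one (`Prop15_i`); (d) Prop. 1.5 (i)′ — any two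
  compatible systems are compatibly isomorphic (`Prop15_i'`). Binders BY NAME: Prop. 1.5 (ii), (iii) of [EtTh] §1
  (`Prop15ii`, `Prop15iii`), the cusp labels `CuspLabels`, `IsSlimGroup Π^tp_X` (G-w4d021-3), `IsOpenMap D.aug`
  (G-L2d3-4), `ThetaEnvTower.Cor219_iii`, the Thm. 1.6 (i) sub-DAG inputs — K-core extension only `hext₀`
  (G-L6d6-2), [AbsAnab] Lem. 1.3.8 `hΔ`, `Thm16Sub.KerToZIsCompactlyGenerated` (L02, G-L6d6-1),
  `Thm16Sub.GKNIsKernelOfAction D 2` (L04, G-w5d051-1), `Thm16Sub.GtpYNFromCusp D 2` (L05),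
  `D.IsoPreservesCuspidalDecomp D` (L03, [SemiAnbd] Thm. 6.5 (iii)), a cusp of `Y^log` in `Π^tp_Y`, the Cor. 2.9
  cusp-label clause — and the §1 origin hypotheses `IsEtThOrigin` (F-2498), `hYcl` (G-w4d021-2).
(The existence clause `Nonempty (ThetaEnvData modelSystem)` is ALREADY abc-iut-L2-t10's `nonempty_thetaEnvData_of_origin`,
whose conclusion does not mention the Cor. 2.18 (i) binder — cite it with
`h218i₁ := cor218_i_chain_of_thm16Inputs … ⟨1, τ.one_mem⟩`; not restated here.)
HONEST FRAMING: CONDITIONAL composition modulo the inputs listed, which are NOT asserted; [EtTh] is refereed, the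
[IUTchII] claim key `Mochizuki2012` is DISPUTED (D-0012); nothing disputed is asserted; no side is taken on
[IUTchIII] Cor. 3.12; typed ≠ discharged.
-/

noncomputable section

namespace Literature.IUT.HodgeArakelov

open Literature.AnabelianGeometry.EtaleTheta Literature.AnabelianGeometry.SemiGraphs
open Literature.AlgebraicGeometry.Frobenioids (IsSlimGroup)
open scoped Literature.AnabelianGeometry.EtaleTheta

namespace EtaleLevels

variable {p : ℕ} [Fact p.Prime] {D : Literature.AnabelianGeometry.EtaleTheta.ThetaSetting p}
  {E : D.EtaleThetaData} {l : ℕ} (C : E.DoubleUnderline l) (hC : D.Compat) (hS : D.Sec2Hyps)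
  (hl : l.Prime) (hp2 : p ≠ 2) (hpl : p ≠ l) (hζ : ∃ ζ : D.K, IsPrimitiveRoot ζ (4 * l))
  {Es : Set ℕ+} (τ : D.CyclotomeTower l Es)
  (f : contCocycles D.toTheta D.DeltaTheta C.GtpYdduu) (hf : f ∈ C.rootCocycles hC)
  (hslimX : IsSlimGroup D.PiTemp) (haugOpen : IsOpenMap D.aug)
  (h15 : Literature.AnabelianGeometry.EtaleTheta.ThetaSetting.Prop15iii E hC)
  (h15ii : Literature.AnabelianGeometry.EtaleTheta.ThetaSetting.Prop15ii E.toKummerData hC)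
  (L : C.CuspLabels)
  (hext₀ : ∀ γ : ↥C.Huu ≃ₜ* ↥C.Huu, ∃ Γ : D.PiTemp ≃ₜ* D.PiTemp,
    ∀ h : C.Huu, Γ (h : D.PiTemp) = ((γ h : C.Huu) : D.PiTemp))
  (hΔ : ∀ Γ : D.PiTemp ≃ₜ* D.PiTemp, D.DeltaTemp.map Γ.toMulEquiv.toMonoidHom = D.DeltaTemp)
  (hZ : Thm16Sub.KerToZIsCompactlyGenerated D) (hK : Thm16Sub.GKNIsKernelOfAction D 2)
  (hYN : Thm16Sub.GtpYNFromCusp D 2) (h65 : D.IsoPreservesCuspidalDecomp D.toTemperedCurve)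
  (hex : ∃ Dc : Subgroup D.PiTemp, D.IsCuspidalDecompositionGroup Dc ∧ Dc ≤ D.GtpY)
  (hcusp : ∀ (γ : ↥C.Huu ≃ₜ* ↥C.Huu) (a : ZMod l),
    (fun H : Subgroup C.Huu => H.map γ.toMulEquiv.toMonoidHom) '' L.cuspX a = L.cuspX a)
  (h219iii : (C.thetaEnvTower τ hC hS).Cor219_iii) (hO : D.IsEtThOrigin)
  (hYcl : (D.DtpY.map D.toHat.toMonoidHom).topologicalClosure ≤
    D.DtpY.map D.toHat.toMonoidHom ⊔ (⁅⁅D.DeltaHat, D.DeltaHat⁆, D.DeltaHat⁆).topologicalClosure)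

include hext₀ hΔ hZ hK hYN h65 hex hcusp in
/-- **[EtTh] Cor. 2.18 (i) at EVERY level of the compatible cyclotome tower `τ`, from the Thm. 1.6 (i) sub-DAG
inputs** — the hypothesis `h218i` of abc-iut-L2-t10's / abc-iut-w4-d030's natural-system theorems
(`prop15_ii_iii_modelSystem_of_origin`, `transitionsAreIsos_modelSystem_of_origin`, `prop15_i_modelSystem_of_origin`, …):
abc-iut-L6-d6's `rigidData_cor218_i_of_thm16Inputs` (p420155) at `μ := τ.mod e`. [cite: MochizukiEtTh2009, Cor 2.18(i) p.60] -/
theorem cor218_i_chain_of_thm16Inputs (e : Es) : (C.rigidData (τ.mod e) hC hS h15 L).Cor218_i :=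
  C.rigidData_cor218_i_of_thm16Inputs (τ.mod e) hC hS h15 L hext₀ hΔ hZ hK hYN h65 hex hcusp

include hslimX haugOpen h15ii hext₀ hΔ hZ hK hYN h65 hex hcusp h219iii in
/-- **[IUTchII] Prop. 1.4 (transitions) / Prop. 1.5 (i) (printed form), (i)′, (ii), (iii) for the NATURAL projective
system of model mono-theta environments of `X̲̲_K` over `ℕ≥1`, with no [EtTh] §2 Cor. 2.18 (i) FACT input (F-0620
supplied from the Thm. 1.6 (i) sub-DAG; Cor. 2.19 (iii), F-0650 → F-0652, remains BY NAME as `h219iii`)** — four conjuncts: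
(a) `transitionsAreIsos` (abc-iut-L2-t10's `transitionsAreIsos_modelSystem_of_origin`); (b) `Prop15_ii_iii` of the
natural system (`prop15_ii_iii_modelSystem_of_origin`); (c) Prop. 1.5 (i) as printed, "uniquely determined, up to
isomorphism, by `X̲̲_k`": every compatible system `B` over the model family is isomorphic to the natural one
(`prop15_i_modelSystem_of_origin`); (d) Prop. 1.5 (i)′: any two compatible systems are compatibly isomorphic
(`prop15_i'_of_cyclotomeTower_of_facts` with `hZ` from abc-iut-L2-d1) — each with its binder «[EtTh] Cor. 2.18 (i) at
every chain level» SUPPLIED by `cor218_i_chain_of_thm16Inputs`. Residual inputs BY NAME: `Prop15ii`, `Prop15iii`,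
`CuspLabels`, `IsSlimGroup Π^tp_X`, `IsOpenMap D.aug`, `ThetaEnvTower.Cor219_iii`, the Thm. 1.6 (i) sub-DAG inputs
(`hext₀`, `hΔ`, L02/L04/L05/L03, a cusp of `Y^log`, the Cor. 2.9 label clause), `IsEtThOrigin`, `hYcl`.
[claim: Mochizuki2012, status: disputed] (IUTchII §1 Prop 1.5, kurims p.29) -/
theorem prop14_15_modelSystem_of_thm16Inputs :
    (modelSystem C hC hS hl hp2 hpl hζ τ.modAll f hf τ.red_modAll h15 L (fun M =>
        ModelCyclotomes.nonempty_lDeltaQuot_rigidData_mulEquiv_zHat C (τ.modAll M) hC hS h15 L hO hYcl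
          hl.ne_zero)).transitionsAreIsos ∧
      Literature.IUT.HodgeArakelov.Prop15_ii_iii
        (modelSystem C hC hS hl hp2 hpl hζ τ.modAll f hf τ.red_modAll h15 L (fun M =>
          ModelCyclotomes.nonempty_lDeltaQuot_rigidData_mulEquiv_zHat C (τ.modAll M) hC hS h15 L hO hYcl
            hl.ne_zero)) ∧
      (∀ (B : MonoThetaProjSystem (modelFamily C hC hS hl hp2 hpl hζ τ.modAll f hf)),
        B.IsMonoThetaCompatible (reductions C hC hS hl hp2 hpl hζ τ.modAll f hf τ.red_modAll hslimX) →
        Prop15_i (modelSystem C hC hS hl hp2 hpl hζ τ.modAll f hf τ.red_modAll h15 L (fun M =>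
          ModelCyclotomes.nonempty_lDeltaQuot_rigidData_mulEquiv_zHat C (τ.modAll M) hC hS h15 L hO hYcl
            hl.ne_zero)) B) ∧
      ∀ (A B : MonoThetaProjSystem (modelFamily C hC hS hl hp2 hpl hζ τ.modAll f hf)),
        Literature.IUT.HodgeArakelov.Prop15_i'
          (reductions C hC hS hl hp2 hpl hζ τ.modAll f hf τ.red_modAll hslimX) A B := by
  have h218i : ∀ e : Es, (C.rigidData (τ.mod e) hC hS h15 L).Cor218_i :=
    cor218_i_chain_of_thm16Inputs C hC hS τ h15 L hext₀ hΔ hZ hK hYN h65 hex hcusp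
  obtain ⟨hii, hi, hi'⟩ := prop15_i_i'_ii_iii_modelSystem_of_origin C hC hS hl hp2 hpl hζ τ f hf hslimX haugOpen
    h15 h15ii L h218i h219iii hO hYcl
  exact ⟨transitionsAreIsos_modelSystem_of_origin C hC hS hl hp2 hpl hζ τ f hf h15 h15ii L h218i h219iii hO hYcl,
    hii, hi, hi'⟩

end EtaleLevels

end Literature.IUT.HodgeArakelov

end
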